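import Summits.ResolutionOfSingularities.ResolutionOfSingularities.Theses.RuledResidues

/-!
# `RuledResidues.NonRuledDivisors` — line `automorphism-orbit`, stub `stub_transportPlace`

Registered stub of `Cruxes/NonRuledDivisors/Lines/automorphism_orbit.lean` (crux stmt-ResolutionOfSingularities-18075),
proved verbatim (signature = the registered one).  Transport of the place data (constants, DVR, essentially-finite-type algebra, the affine model, domination) along `W ↦ W.comap τ`.

Let `τ` be a ring automorphism of the field `K`, semilinear over an automorphism `ι` of `k`
(`τ (c·1) = (ι c)·1`), mapping the affine model `R` into itself and the prime `P` into itself, and let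
`W' = W.comap τ = {y | τ y ∈ W}`.  Then `τ` restricts to a ring isomorphism `W' ≃+* W`, so `W'` is a DVR
when `W` is; `k ⊆ W'` by semilinearity; if `W` is the localisation of the finitely generated
`k`-subalgebra `B = k[s]` at its centre then `W'` is the localisation of `τ⁻¹(B) = k[τ⁻¹ s]`;
`R ⊆ W'` because `τ R ⊆ R ⊆ W`; and `P` consists of non-units of `W'` because `τ P ⊆ P ⊆ 𝔪_W`.
-/

-- dupNamespace: the problem namespace legitimately repeats the summit name
set_option linter.dupNamespace false

namespace Summit.ResolutionOfSingularities.ResolutionOfSingularities.Theorems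

section TransportPlace

variable {k K : Type} [Field k] [Field K] [Algebra k K]

/-- Membership in the pulled-back place: `y ∈ W.comap τ ↔ τ y ∈ W`. -/
theorem transportPlace_mem_comap (W : ValuationSubring K) (τ : K ≃+* K) (y : K) :
    y ∈ W.comap (τ : K →+* K) ↔ τ y ∈ W :=
  ValuationSubring.mem_comap

/-- Non-units of the pulled-back place: `y` is a non-unit of `W.comap τ` iff `τ y` is a non-unit
of `W`. -/
theorem transportPlace_mem_nonunits_comap (W : ValuationSubring K) (τ : K ≃+* K) (y : K) :
    y ∈ (W.comap (τ : K →+* K)).nonunits ↔ τ y ∈ W.nonunits := by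
  rw [ValuationSubring.mem_nonunits_iff_or, ValuationSubring.mem_nonunits_iff_or,
    transportPlace_mem_comap, map_inv₀, EmbeddingLike.map_eq_zero_iff]

/-- The pull-back of a discrete valuation ring of `K` along a ring automorphism of `K` is a
discrete valuation ring (`τ` restricts to a ring isomorphism `W.comap τ ≃+* W`). -/
theorem transportPlace_dvr (W : ValuationSubring K) (τ : K ≃+* K) [IsDiscreteValuationRing W] :
    IsDiscreteValuationRing (W.comap (τ : K →+* K)) :=
  IsDiscreteValuationRing.RingEquivClass.isDiscreteValuationRing (A := W)
    (B := W.comap (τ : K →+* K))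
    ({ toFun := fun y => ⟨τ.symm y.1, by
          rw [transportPlace_mem_comap, RingEquiv.apply_symm_apply]; exact y.2⟩,
       invFun := fun x => ⟨τ x.1, (transportPlace_mem_comap W τ x.1).mp x.2⟩,
       left_inv := fun y => Subtype.ext (τ.apply_symm_apply y.1),
       right_inv := fun x => Subtype.ext (τ.symm_apply_apply x.1),
       map_mul' := fun y z => Subtype.ext (map_mul τ.symm y.1 z.1),
       map_add' := fun y z => Subtype.ext (map_add τ.symm y.1 z.1) } :
      W ≃+* W.comap (τ : K →+* K))

/-- The inverse of a `ι`-semilinear ring automorphism is `ι⁻¹`-semilinear. -/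
theorem transportPlace_symm_semilinear (τ : K ≃+* K) (ι : k ≃+* k)
    (hsemi : ∀ c : k, τ (algebraMap k K c) = algebraMap k K (ι c)) (c : k) :
    τ.symm (algebraMap k K c) = algebraMap k K (ι.symm c) := by
  apply τ.injective
  rw [RingEquiv.apply_symm_apply, hsemi, RingEquiv.apply_symm_apply]

/-- The preimage of a `k`-subalgebra of `K` under a ring automorphism of `K` that is semilinear over
an automorphism of `k` is again a `k`-subalgebra (recorded through its membership predicate). -/
theorem transportPlace_exists_preimage_subalgebra (σ : K ≃+* K) (κ : k ≃+* k)
    (hσ : ∀ c : k, σ (algebraMap k K c) = algebraMap k K (κ c)) (C : Subalgebra k K) :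
    ∃ C' : Subalgebra k K, ∀ x : K, x ∈ C' ↔ σ x ∈ C := by
  refine ⟨{ C.toSubring.comap (σ : K →+* K) with
    algebraMap_mem' := fun c => ?_ }, fun x => Iff.rfl⟩
  show σ (algebraMap k K c) ∈ C
  rw [hσ]
  exact C.algebraMap_mem (κ c)

/-- The semilinear preimage `τ⁻¹(B)` of a finitely generated `k`-subalgebra `B = k[s]` is finitely
generated, namely `τ⁻¹(B) = k[τ⁻¹ s]`. -/
theorem transportPlace_fg_preimage (τ : K ≃+* K) (ι : k ≃+* k)
    (hsemi : ∀ c : k, τ (algebraMap k K c) = algebraMap k K (ι c)) (B B' : Subalgebra k K)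
    (hB' : ∀ x : K, x ∈ B' ↔ τ x ∈ B) (hfg : B.FG) : B'.FG := by
  classical
  obtain ⟨s, rfl⟩ := hfg
  refine ⟨s.image τ.symm, ?_⟩
  rw [Finset.coe_image]
  apply le_antisymm
  · apply Algebra.adjoin_le
    rintro _ ⟨y, hy, rfl⟩
    rw [SetLike.mem_coe, hB', RingEquiv.apply_symm_apply]
    exact Algebra.subset_adjoin hy
  · intro x hx
    rw [hB'] at hx
    obtain ⟨C', hC'⟩ := transportPlace_exists_preimage_subalgebra τ.symm ι.symm
      (transportPlace_symm_semilinear τ ι hsemi) (Algebra.adjoin k (τ.symm '' (↑s : Set K)))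
    have hle : Algebra.adjoin k (↑s : Set K) ≤ C' := by
      apply Algebra.adjoin_le
      intro y hy
      rw [SetLike.mem_coe, hC']
      exact Algebra.subset_adjoin ⟨y, hy, rfl⟩
    have hx' := (hC' _).mp (hle hx)
    rwa [RingEquiv.symm_apply_apply] at hx'

/-- Transport of "essentially of finite type over `k`" along `W ↦ W.comap τ`: if `W` is the
localisation of a finitely generated `k`-subalgebra `B ⊆ W` at its centre, then `W.comap τ` is the
localisation of the finitely generated `k`-subalgebra `τ⁻¹(B) ⊆ W.comap τ` at its centre. -/
theorem transportPlace_eft (τ : K ≃+* K) (ι : k ≃+* k)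
    (hsemi : ∀ c : k, τ (algebraMap k K c) = algebraMap k K (ι c)) (W : ValuationSubring K)
    (hft : ∃ B : Subalgebra k K, B.FG ∧ B.toSubring ≤ W.toSubring ∧
      ∀ x : K, x ∈ W → ∃ b s : K, b ∈ B ∧ s ∈ B ∧ s ∉ W.nonunits ∧ x * s = b) :
    ∃ B : Subalgebra k K, B.FG ∧ B.toSubring ≤ (W.comap (τ : K →+* K)).toSubring ∧
      ∀ x : K, x ∈ W.comap (τ : K →+* K) →
        ∃ b s : K, b ∈ B ∧ s ∈ B ∧ s ∉ (W.comap (τ : K →+* K)).nonunits ∧ x * s = b := by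
  obtain ⟨B, hBfg, hBW, hfrac⟩ := hft
  obtain ⟨B', hB'⟩ := transportPlace_exists_preimage_subalgebra τ ι hsemi B
  refine ⟨B', transportPlace_fg_preimage τ ι hsemi B B' hB' hBfg, ?_, ?_⟩
  · intro x hx
    rw [Subalgebra.mem_toSubring, hB'] at hx
    rw [ValuationSubring.mem_toSubring, transportPlace_mem_comap]
    exact hBW (Subalgebra.mem_toSubring.mpr hx)
  · intro x hx
    rw [transportPlace_mem_comap] at hx
    obtain ⟨b, s, hb, hs, hsW, hxs⟩ := hfrac (τ x) hx
    refine ⟨τ.symm b, τ.symm s, (hB' _).mpr ?_, (hB' _).mpr ?_, ?_, ?_⟩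
    · rw [RingEquiv.apply_symm_apply]; exact hb
    · rw [RingEquiv.apply_symm_apply]; exact hs
    · rw [transportPlace_mem_nonunits_comap, RingEquiv.apply_symm_apply]; exact hsW
    · apply τ.injective
      rw [map_mul, RingEquiv.apply_symm_apply, RingEquiv.apply_symm_apply]
      exact hxs

end TransportPlace

/-- Stub 2a of line `automorphism-orbit` (crux `RuledResidues.NonRuledDivisors`): the pulled-back place `W.comap τ` again contains `k` and `R`, is a DVR essentially of finite type over `k`, and dominates `P`. [folklore] -/
theorem stub_transportPlace : ∀ (k K : Type) [Field k] [Field K] [Algebra k K] (R : Subalgebra k K) (P : Ideal R.toSubring) (τ : K ≃+* K) (ι : k ≃+* k), (∀ c : k, τ (algebraMap k K c) = algebraMap k K (ι c)) → (∀ r : K, r ∈ R → τ r ∈ R) → (∀ r : R.toSubring, r ∈ P → ∃ r' : R.toSubring, r' ∈ P ∧ (r' : K) = τ (r : K)) → ∀ (W W' : ValuationSubring K), W' = W.comap (τ : K →+* K) → (∀ c : k, algebraMap k K c ∈ W) → IsDiscreteValuationRing W → (∃ B : Subalgebra k K, B.FG ∧ B.toSubring ≤ W.toSubring ∧ ∀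 x : K, x ∈ W → ∃ b s : K, b ∈ B ∧ s ∈ B ∧ s ∉ W.nonunits ∧ x * s = b) → R.toSubring ≤ W.toSubring → (∀ r : R.toSubring, r ∈ P → (r : K) ∈ W.nonunits) → (∀ c : k, algebraMap k K c ∈ W') ∧ IsDiscreteValuationRing W' ∧ (∃ B : Subalgebra k K, B.FG ∧ B.toSubring ≤ W'.toSubring ∧ ∀ x : K, x ∈ W' → ∃ b s : K, b ∈ B ∧ s ∈ B ∧ s ∉ W'.nonunits ∧ x * s = b) ∧ R.toSubring ≤ W'.toSubring ∧ (∀ r : R.toSubring, r ∈ P → (r : K) ∈ W'.nonunits) := by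
  intro k K _ _ _ R P τ ι hsemi hR hP W W' hW' hk hdvr hft hle hdom
  subst hW'
  refine ⟨?_, ?_, transportPlace_eft τ ι hsemi W hft, ?_, ?_⟩
  · intro c
    rw [transportPlace_mem_comap, hsemi]
    exact hk (ι c)
  · haveI := hdvr
    exact transportPlace_dvr W τ
  · intro x hx
    rw [ValuationSubring.mem_toSubring, transportPlace_mem_comap]
    exact hle (Subalgebra.mem_toSubring.mpr (hR x (Subalgebra.mem_toSubring.mp hx)))
  · intro r hr
    obtain ⟨r', hr'P, hr'eq⟩ := hP r hr
    rw [transportPlace_mem_nonunits_comap, ← hr'eq]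
    exact hdom r' hr'P

end Summit.ResolutionOfSingularities.ResolutionOfSingularities.Theorems
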